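import Literature.Probability.LatticeModels.FieldCurrentsSingleSpin
import Literature.Probability.LatticeModels.CouplingPathCalculus
import HarnessLib

/-!
# Aizenman–Fernández's Proposition 5.2: the bound on the third cumulant `⟨σ_x; σ_yσ_z; σ_kσ_l⟩`, summed over `x`

Topic `Probability/LatticeModels`, namespace `Literature.Probability.LatticeModels`. Sequel of
`FieldCurrentsSingleSpin` ((3.15) for general sets, the expansion over the cluster of `x`, the
(3.16)-inequality, the triple-term bound (5.10)) and `CouplingPathCalculus` (the third cumulant
`thetaK3`, the weak GHS inequality).

Aizenman–Fernández 1986, Prop. 5.2 ((5.4), p. 425): for the Ising model in a field,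

  `⟨σ_x; σ_yσ_z; σ_kσ_l⟩ ≤ {[2⟨σ_x;σ_y⟩⟨σ_kσ_z⟩_{h=0}⟨σ_l⟩ + (k ⇔ l)] + [(yz) ⇔ (kl)]} + ½{y ⇔ z}`,

proved from the representation (3.19) of the cumulant through currents with the sources
`{x} Δ A₁`, `A₁` the (odd) set of the spins `y, z, k, l` in the cluster of `x`, the bound (5.9) on
the terms with `|A₁| = 1` ((3.16) in the depleted system and Griffiths) and (5.10) on those with
`|A₁| = 3` (switching). What is used in the proof of Thm. 5.7 ((5.50)–(5.51)) is this bound for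
the *diluted* systems, with the truncated factor summed over `x` by `∑_x ⟨σ_x;σ_a⟩ ≤ M/(βh)` and
the other factors bounded by their values in the full system. This file proves exactly that
statement (`sum_thetaK3_le`): for couplings `0 ≤ θ' ≤ θ` with the same uniform field `s > 0`
(`θ'_{z,g} = s`) and two distinct lattice bonds `e = {u,v}`, `e' = {k,l}` inside `Λ`,

  `∑_{x ∈ Λ} κ₃^{θ'}(σ_x; σ_e; σ_{e'}) ≤ 12 · M̄ (M̄/s + 1) · ∑_{b ∈ e} ∑_{c ∈ e'} ⟨σ_bσ_c⟩_{θ,h=0}`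

where `M̄` bounds the one-point functions `⟨σ_a⟩_θ`. The per-`x` bound for `x` off the two
(disjoint) bonds is `thetaK3_disjoint_le` (the twelve terms of (5.4), organised by the odd set
`A₁`; the terms `|A₁| = 1` use `thetaTrunc_three_le` in the depleted system `θ'_S`, the terms
`|A₁| = 3` use `currentPairSum_four_conn_le`); the coincident cases `x ∈ e ∪ e'` and adjacent
bonds are elementary (`thetaK3_le_trunc`, `thetaK3_coincident_le`).

## References

* M. Aizenman, R. Fernández, J. Stat. Phys. **44** (1986) 393–454, §3.4 Cor. 3.7 (3.19), p. 415;
  §5.1 Prop. 5.2, (5.4)–(5.10), pp. 425–427; §5.2, (5.50)–(5.51), pp. 440–441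
  [AizenmanFernandezJSP1986] (held: author copy `paper:url-b8cebc3f44bb`, PDF pp. 23, 33–35, 48).
-/

noncomputable section

open Finset MeasureTheory
open scoped symmDiff ENNReal

namespace Literature.Probability.LatticeModels

variable {V : Type*} [DecidableEq V]

section Kappa3

variable {G : SimpleGraph V} [G.LocallyFinite] {Λ : Finset V}

local notation "Gg" => ghostGraph G Λ
local notation "Λg" => Finset.insertNone Λ
local notation "Eg" => edgesIn (ghostGraph G Λ) (Finset.insertNone Λ)
local notation "Zg[" θ ", " X "]" =>
  gcurrentZ (ghostGraph G Λ) (Finset.insertNone Λ) θ (edgesIn (ghostGraph G Λ) (Finset.insertNone Λ)) X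
local notation "Conn[" m ", " u ", " v "]" =>
  CConn (ghostGraph G Λ) (Finset.insertNone Λ) m (edgesIn (ghostGraph G Λ) (Finset.insertNone Λ)) u v
local notation "∂g" => csources (ghostGraph G Λ) (Finset.insertNone Λ)
local notation "𝒮[" m ", " b "]" => clusterCompl (ghostGraph G Λ) (Finset.insertNone Λ) m b

/-! ### The third cumulant of a spin and two spin products, in terms of correlations -/

/-- `κ₃(σ_x; σ_E; σ_{E'}) = ⟨σ_x;σ_{EΔE'}⟩ - ⟨σ_{E'}⟩⟨σ_x;σ_E⟩ - ⟨σ_E⟩⟨σ_x;σ_{E'}⟩` with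
`⟨σ_x;σ_B⟩ = ⟨σ_{{x}ΔB}⟩ - ⟨σ_x⟩⟨σ_B⟩` (since `σ_Eσ_{E'} = σ_{EΔE'}`). [cite: AizenmanFernandezJSP1986, §3.4, Cor. 3.7, eq. (3.19), p. 415] -/
theorem thetaK3_spin_prod_prod_eq (θ : Sym2 (Option V) → ℝ) (x : V) (E E' : Finset V) :
    thetaK3 G Λ θ (spinAt x) (spinProduct E) (spinProduct E') =
      (thetaCorr G Λ θ ({x} ∆ (E ∆ E')) - thetaCorr G Λ θ {x} * thetaCorr G Λ θ (E ∆ E')) -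
        thetaCorr G Λ θ E' * (thetaCorr G Λ θ ({x} ∆ E) - thetaCorr G Λ θ {x} * thetaCorr G Λ θ E) -
        thetaCorr G Λ θ E * (thetaCorr G Λ θ ({x} ∆ E') - thetaCorr G Λ θ {x} * thetaCorr G Λ θ E') := by
  have hx : (spinAt x : SpinConfig V → ℝ) = spinProduct {x} := (spinProduct_singleton x).symm
  have e1 : (fun σ => spinAt x σ * spinProduct E σ * spinProduct E' σ) = spinProduct ({x} ∆ (E ∆ E')) := by
    funext σ; rw [hx, spinProduct_mul_spinProduct, spinProduct_mul_spinProduct, symmDiff_assoc]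
  have e2 : (fun σ => spinAt x σ * spinProduct E σ) = spinProduct ({x} ∆ E) := by
    funext σ; rw [hx, spinProduct_mul_spinProduct]
  have e3 : (fun σ => spinAt x σ * spinProduct E' σ) = spinProduct ({x} ∆ E') := by
    funext σ; rw [hx, spinProduct_mul_spinProduct]
  have e4 : (fun σ => spinProduct E σ * spinProduct E' σ) = spinProduct (E ∆ E') := by
    funext σ; rw [spinProduct_mul_spinProduct]
  unfold thetaK3
  rw [e1, e2, e3, e4, hx]
  unfold thetaCorr
  ring

/-- **Dropping the two subtracted truncations** (GKS II): for `θ ≥ 0`, `x ∈ Λ`, `E, E' ⊆ Λ`,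
`κ₃(σ_x; σ_E; σ_{E'}) ≤ ⟨σ_x; σ_{EΔE'}⟩`. [cite: AizenmanFernandezJSP1986, §5.1, proof of Prop. 5.2, eq. (5.7), p. 426] -/
theorem thetaK3_le_trunc {θ : Sym2 (Option V) → ℝ} (hθ : ∀ e, 0 ≤ θ e) {x : V} (hx : x ∈ Λ) {E E' : Finset V}
    (hE : E ⊆ Λ) (hE' : E' ⊆ Λ) :
    thetaK3 G Λ θ (spinAt x) (spinProduct E) (spinProduct E') ≤
      thetaCorr G Λ θ ({x} ∆ (E ∆ E')) - thetaCorr G Λ θ {x} * thetaCorr G Λ θ (E ∆ E') := by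
  rw [thetaK3_spin_prod_prod_eq]
  have h1 : 0 ≤ thetaCorr G Λ θ ({x} ∆ E) - thetaCorr G Λ θ {x} * thetaCorr G Λ θ E :=
    sub_nonneg.2 (thetaCorr_mul_le_symmDiff hθ (singleton_subset_iff.2 hx) hE)
  have h2 : 0 ≤ thetaCorr G Λ θ ({x} ∆ E') - thetaCorr G Λ θ {x} * thetaCorr G Λ θ E' :=
    sub_nonneg.2 (thetaCorr_mul_le_symmDiff hθ (singleton_subset_iff.2 hx) hE')
  have hE0 : 0 ≤ thetaCorr G Λ θ E := thetaCorr_nonneg hθ hE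
  have hE0' : 0 ≤ thetaCorr G Λ θ E' := thetaCorr_nonneg hθ hE'
  nlinarith [mul_nonneg hE0' h1, mul_nonneg hE0 h2]

/-- **The coincident case `x ∈ E`** (here `E = {x} Δ {v}`): for `θ ≥ 0`,
`κ₃(σ_x; σ_xσ_v; σ_{E'}) ≤ ⟨σ_v; σ_{E'}⟩` (`σ_x² = 1` and two GKS II signs). [cite: AizenmanFernandezJSP1986, §5.1, Prop. 5.2 (coincident cases), p. 426] -/
theorem thetaK3_coincident_le {θ : Sym2 (Option V) → ℝ} (hθ : ∀ e, 0 ≤ θ e) {x v : V} (hx : x ∈ Λ) (hv : v ∈ Λ)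
    {E' : Finset V} (hE' : E' ⊆ Λ) :
    thetaK3 G Λ θ (spinAt x) (spinProduct ({x} ∆ {v})) (spinProduct E') ≤
      thetaCorr G Λ θ ({v} ∆ E') - thetaCorr G Λ θ {v} * thetaCorr G Λ θ E' := by
  rw [thetaK3_spin_prod_prod_eq]
  have hxv' : ({x} ∆ {v} : Finset V) ⊆ Λ := symmDiff_le_sup.trans (sup_le (singleton_subset_iff.2 hx) (singleton_subset_iff.2 hv))
  have e1 : ({x} ∆ (({x} ∆ {v}) ∆ E') : Finset V) = {v} ∆ E' := by
    rw [symmDiff_assoc, symmDiff_symmDiff_cancel_left]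
  have e2 : ({x} ∆ ({x} ∆ {v}) : Finset V) = {v} := symmDiff_symmDiff_cancel_left _ _
  rw [e1, e2]
  -- the two dropped terms
  have h1 : 0 ≤ thetaCorr G Λ θ (({x} ∆ {v}) ∆ E') - thetaCorr G Λ θ ({x} ∆ {v}) * thetaCorr G Λ θ E' :=
    sub_nonneg.2 (thetaCorr_mul_le_symmDiff hθ hxv' hE')
  have h2 : 0 ≤ thetaCorr G Λ θ ({x} ∆ E') - thetaCorr G Λ θ {x} * thetaCorr G Λ θ E' :=
    sub_nonneg.2 (thetaCorr_mul_le_symmDiff hθ (singleton_subset_iff.2 hx) hE')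
  have hx0 : 0 ≤ thetaCorr G Λ θ {x} := thetaCorr_nonneg hθ (singleton_subset_iff.2 hx)
  have hE0 : 0 ≤ thetaCorr G Λ θ ({x} ∆ {v}) := thetaCorr_nonneg hθ hxv'
  nlinarith [mul_nonneg hx0 h1, mul_nonneg hE0 h2]

/-! ### Small set algebra -/

omit [DecidableEq V] in
/-- `({a} Δ {b}) Δ ({c} Δ {d}) = {a, b, c, d}` for distinct `a, b, c, d`. [folklore] -/
theorem pair_symmDiff_pair_eq_four {α : Type*} [DecidableEq α] {a b c d : α} (hab : a ≠ b) (hac : a ≠ c) (had : a ≠ d)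
    (hbc : b ≠ c) (hbd : b ≠ d) (hcd : c ≠ d) :
    (({a} ∆ {b}) ∆ ({c} ∆ {d}) : Finset α) = {a, b, c, d} := by
  rw [Current.symmDiff_singleton_eq_pair hab, Current.symmDiff_singleton_eq_pair hcd]
  ext v; simp only [mem_symmDiff, mem_insert, mem_singleton]
  constructor
  · rintro (⟨h | h, -⟩ | ⟨h | h, -⟩) <;> simp [h]
  · rintro (rfl | rfl | rfl | rfl)
    · exact Or.inl ⟨Or.inl rfl, fun h => by rcases h with h | h <;> [exact hac h; exact had h]⟩
    · exact Or.inl ⟨Or.inr rfl, fun h => by rcases h with h | h <;> [exact hbc h; exact hbd h]⟩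
    · exact Or.inr ⟨Or.inl rfl, fun h => by rcases h with h | h <;> [exact hac h.symm; exact hbc h.symm]⟩
    · exact Or.inr ⟨Or.inr rfl, fun h => by rcases h with h | h <;> [exact had h.symm; exact hbd h.symm]⟩

/-- `({x} Δ ({u}Δ{v}) Δ ({k}Δ{l}))* = {x, u, v, k, l, g}` for distinct `x, u, v, k, l`. [folklore] -/
theorem starSet_five_eq {x u v k l : V} (hxu : x ≠ u) (hxv : x ≠ v) (hxk : x ≠ k) (hxl : x ≠ l) (huv : u ≠ v)
    (huk : u ≠ k) (hul : u ≠ l) (hvk : v ≠ k) (hvl : v ≠ l) (hkl : k ≠ l) :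
    starSet ({x} ∆ (({u} ∆ {v}) ∆ ({k} ∆ {l}))) = ({some x, some u, some v, some k, some l, none} : Finset (Option V)) := by
  have hset : ({x} ∆ (({u} ∆ {v}) ∆ ({k} ∆ {l})) : Finset V) = {x, u, v, k, l} := by
    rw [pair_symmDiff_pair_eq_four huv huk hul hvk hvl hkl]
    ext a; simp only [mem_symmDiff, mem_singleton, mem_insert]
    constructor
    · rintro (⟨rfl, -⟩ | ⟨h, -⟩) <;> simp_all
    · rintro (rfl | rfl | rfl | rfl | rfl)
      · exact Or.inl ⟨rfl, by simp [hxu, hxv, hxk, hxl]⟩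
      · exact Or.inr ⟨by simp, fun h => hxu h.symm⟩
      · exact Or.inr ⟨by simp, fun h => hxv h.symm⟩
      · exact Or.inr ⟨by simp, fun h => hxk h.symm⟩
      · exact Or.inr ⟨by simp, fun h => hxl h.symm⟩
  have hcard : #({x, u, v, k, l} : Finset V) = 5 := by
    rw [card_insert_of_notMem (by simp [hxu, hxv, hxk, hxl]), card_insert_of_notMem (by simp [huv, huk, hul]),
      card_insert_of_notMem (by simp [hvk, hvl]), card_pair hkl]
  rw [hset, starSet, if_neg (by rw [hcard]; decide)]
  ext w
  cases w with
  | none => simp [Finset.mem_insertNone]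
  | some a => simp [Finset.mem_insertNone]

/-! ### The expansion in real numbers -/

/-- `∑ w w 𝟙[x ↮ g] F = ∑_{S ∋ g} ∑ w w 𝟙[𝒮_x = S] F`, in real numbers, for `F ≤ 1`. [cite: AizenmanFernandezJSP1986, §3.4, Prop. 3.4, eq. (3.14), p. 412] -/
theorem toReal_currentPairSum_notConn_single_eq_sum {θ : Sym2 (Option V) → ℝ} (hθ : ∀ e, 0 ≤ θ e) (x : V)
    (Y : Finset (Option V)) {F : (Eg → ℕ) → ℝ≥0∞} (hF : ∀ m, F m ≤ 1) :
    (currentPairSum G Λ θ Y ∅ (fun m => ind (¬Conn[m, some x, none]) * F m)).toReal =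
      ∑ S ∈ (Λg).powerset.filter (fun S => (none : Option V) ∈ S),
        (currentPairSum G Λ θ Y ∅ (fun m => ind (𝒮[m, some x] = S) * F m)).toReal := by
  rw [currentPairSum_notConn_single_eq_sum, ENNReal.toReal_sum (fun S _ =>
    currentPairSum_ne_top hθ _ _ fun m => le_trans (mul_le_mul' (ind_le_one _) (hF m)) (by rw [one_mul]))]

/-- The version with `F = 1`. [folklore] -/
theorem toReal_currentPairSum_notConn_single_eq_sum' {θ : Sym2 (Option V) → ℝ} (hθ : ∀ e, 0 ≤ θ e) (x : V)
    (Y : Finset (Option V)) :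
    (currentPairSum G Λ θ Y ∅ (fun m => ind (¬Conn[m, some x, none]))).toReal =
      ∑ S ∈ (Λg).powerset.filter (fun S => (none : Option V) ∈ S),
        (currentPairSum G Λ θ Y ∅ (fun m => ind (𝒮[m, some x] = S))).toReal := by
  have h := toReal_currentPairSum_notConn_single_eq_sum (G := G) (Λ := Λ) hθ x Y (F := fun _ => 1) (fun _ => le_rfl)
  simp only [mul_one] at h
  exact h

/-! ### The per-`x` bound for `x` off two disjoint bonds -/

/-- On `{𝒮_x = S}`, a vertex of `Λ` outside `S` is connected to `x`. [folklore] -/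
theorem cconn_of_clusterCompl_eq_of_not_mem {m : Eg → ℕ} {x a : V} {S : Finset (Option V)} (hS : 𝒮[m, some x] = S)
    (ha : a ∈ Λ) (haS : (some a : Option V) ∉ S) : Conn[m, some x, some a] := by
  by_contra h
  exact haS (hS ▸ mem_clusterCompl.2 ⟨Finset.some_mem_insertNone.2 ha, h⟩)

set_option maxHeartbeats 1600000 in
/-- **Aizenman–Fernández's Proposition 5.2 for `x` off two disjoint bonds, general couplings**:
for `0 ≤ θ' ≤ θ`, distinct `x, u, v, k, l ∈ Λ`, with `⟨·⟩' = ⟨·⟩_{θ'}`, `⟨σ_d⟩ = ⟨σ_d⟩_θ`,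
`⟨σ_bσ_c⟩₀ = ⟨σ_bσ_c⟩_{θ,h=0}`, `T_a = ⟨σ_x;σ_a⟩'`:
`κ₃^{θ'}(σ_x;σ_uσ_v;σ_kσ_l) ≤ c_u T_u + c_v T_v + c_k T_k + c_l T_l + ⟨σ_l⟩⟨σ_vσ_k⟩₀T_u + ⟨σ_k⟩⟨σ_vσ_l⟩₀T_u + ⟨σ_v⟩⟨σ_uσ_k⟩₀T_l + ⟨σ_u⟩⟨σ_vσ_k⟩₀T_l`
with `c_u = ⟨σ_l⟩⟨σ_vσ_k⟩₀ + ⟨σ_k⟩⟨σ_vσ_l⟩₀`, `c_v = ⟨σ_l⟩⟨σ_uσ_k⟩₀ + ⟨σ_k⟩⟨σ_uσ_l⟩₀`,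
`c_k = ⟨σ_v⟩⟨σ_lσ_u⟩₀ + ⟨σ_u⟩⟨σ_lσ_v⟩₀`, `c_l = ⟨σ_v⟩⟨σ_kσ_u⟩₀ + ⟨σ_u⟩⟨σ_kσ_v⟩₀` — the twelve
terms of (5.4), the first eight from the classes `|A₁| = 1` ((5.9)), the last four from
`|A₁| = 3` ((5.10)). [cite: AizenmanFernandezJSP1986, §5.1, Prop. 5.2, eqs. (5.4), (5.6)–(5.10), pp. 425–427] -/
theorem thetaK3_disjoint_le {θ θ' : Sym2 (Option V) → ℝ} (hθ' : ∀ e, 0 ≤ θ' e) (hle : ∀ e, θ' e ≤ θ e)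
    {x u v k l : V} (hx : x ∈ Λ) (hu : u ∈ Λ) (hv : v ∈ Λ) (hk : k ∈ Λ) (hl : l ∈ Λ)
    (hxu : x ≠ u) (hxv : x ≠ v) (hxk : x ≠ k) (hxl : x ≠ l) (huv : u ≠ v) (huk : u ≠ k) (hul : u ≠ l)
    (hvk : v ≠ k) (hvl : v ≠ l) (hkl : k ≠ l) :
    thetaK3 G Λ θ' (spinAt x) (spinProduct ({u} ∆ {v})) (spinProduct ({k} ∆ {l})) ≤
      ((thetaCorr G Λ θ {l} * thetaCorr G Λ (zeroField θ) ({v} ∆ {k}) + thetaCorr G Λ θ {k} * thetaCorr G Λ (zeroField θ) ({v} ∆ {l})) *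
          (thetaCorr G Λ θ' ({x} ∆ {u}) - thetaCorr G Λ θ' {x} * thetaCorr G Λ θ' {u}) +
        (thetaCorr G Λ θ {l} * thetaCorr G Λ (zeroField θ) ({u} ∆ {k}) + thetaCorr G Λ θ {k} * thetaCorr G Λ (zeroField θ) ({u} ∆ {l})) *
          (thetaCorr G Λ θ' ({x} ∆ {v}) - thetaCorr G Λ θ' {x} * thetaCorr G Λ θ' {v}) +
        (thetaCorr G Λ θ {v} * thetaCorr G Λ (zeroField θ) ({l} ∆ {u}) + thetaCorr G Λ θ {u} * thetaCorr G Λ (zeroField θ) ({l} ∆ {v})) *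
          (thetaCorr G Λ θ' ({x} ∆ {k}) - thetaCorr G Λ θ' {x} * thetaCorr G Λ θ' {k}) +
        (thetaCorr G Λ θ {v} * thetaCorr G Λ (zeroField θ) ({k} ∆ {u}) + thetaCorr G Λ θ {u} * thetaCorr G Λ (zeroField θ) ({k} ∆ {v})) *
          (thetaCorr G Λ θ' ({x} ∆ {l}) - thetaCorr G Λ θ' {x} * thetaCorr G Λ θ' {l})) +
      ((thetaCorr G Λ θ {l} * thetaCorr G Λ (zeroField θ) ({v} ∆ {k}) + thetaCorr G Λ θ {k} * thetaCorr G Λ (zeroField θ) ({v} ∆ {l})) *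
          (thetaCorr G Λ θ' ({x} ∆ {u}) - thetaCorr G Λ θ' {x} * thetaCorr G Λ θ' {u}) +
        (thetaCorr G Λ θ {v} * thetaCorr G Λ (zeroField θ) ({u} ∆ {k}) + thetaCorr G Λ θ {u} * thetaCorr G Λ (zeroField θ) ({v} ∆ {k})) *
          (thetaCorr G Λ θ' ({x} ∆ {l}) - thetaCorr G Λ θ' {x} * thetaCorr G Λ θ' {l})) := by
  classical
  have hθ : ∀ e, 0 ≤ θ e := fun e => (hθ' e).trans (hle e)
  -- notation
  set Z : ℝ := (Zg[θ', ∅]).toReal with hZ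
  have hZpos : 0 < Z := toReal_gcurrentZ_ghost_empty_pos subset_rfl hθ' subset_rfl
  have hZ2 : 0 < Z ^ 2 := pow_pos hZpos 2
  set P' := (Λg).powerset.filter (fun S => (none : Option V) ∈ S) with hP'
  set M : V → ℝ := fun d => thetaCorr G Λ θ {d} with hM
  set G0 : V → V → ℝ := fun b c => thetaCorr G Λ (zeroField θ) ({b} ∆ {c}) with hG0
  set Tt : V → ℝ := fun a => thetaCorr G Λ θ' ({x} ∆ {a}) - thetaCorr G Λ θ' {x} * thetaCorr G Λ θ' {a} with hTt
  have hM0 : ∀ d, d ∈ Λ → 0 ≤ M d := fun d hd => thetaCorr_nonneg hθ (singleton_subset_iff.2 hd)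
  have hsub2 : ∀ {b c : V}, b ∈ Λ → c ∈ Λ → ({b} ∆ {c} : Finset V) ⊆ Λ := fun hb hc =>
    symmDiff_le_sup.trans (sup_le (singleton_subset_iff.2 hb) (singleton_subset_iff.2 hc))
  have hG00 : ∀ b c, b ∈ Λ → c ∈ Λ → 0 ≤ G0 b c := fun b c hb hc => thetaCorr_nonneg (zeroField_nonneg hθ) (hsub2 hb hc)
  have hG0symm : ∀ b c, G0 b c = G0 c b := fun b c => by simp only [hG0, symmDiff_comm]
  -- the pair sums
  set Q : Finset (Option V) → Finset (Option V) → ℝ := fun Y S =>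
    (currentPairSum G Λ θ' Y ∅ (fun m => ind (𝒮[m, some x] = S))).toReal with hQ
  have hQ0 : ∀ Y S, 0 ≤ Q Y S := fun Y S => ENNReal.toReal_nonneg
  set q : V → Finset (Option V) → ℝ := fun a S => Q ({some x} ∆ {some a}) S with hq
  have hq0 : ∀ a S, 0 ≤ q a S := fun a S => hQ0 _ _
  set ρ : V → V → V → Finset (Option V) → ℝ := fun a b c S =>
    (currentPairSum G Λ θ' (({some x} ∆ {some a}) ∆ ({some b} ∆ {some c})) ∅
      (fun m => ind (𝒮[m, some x] = S) *
        (ind (Conn[m, some x, some a]) * ind (Conn[m, some x, some b]) * ind (Conn[m, some x, some c])))).toReal with hρ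
  have hρ0 : ∀ a b c S, 0 ≤ ρ a b c S := fun a b c S => ENNReal.toReal_nonneg
  -- the source sets
  set YA : Finset (Option V) := {some x, some u, some v, some k, some l, none} with hYA
  set YE : Finset (Option V) := {some x, some u, some v, none} with hYE
  set YE' : Finset (Option V) := {some x, some k, some l, none} with hYE'
  have hYAΛ : YA ⊆ Λg := by
    intro w hw; simp only [hYA, mem_insert, mem_singleton] at hw
    rcases hw with rfl | rfl | rfl | rfl | rfl | rfl
    · exact Finset.some_mem_insertNone.2 hx
    · exact Finset.some_mem_insertNone.2 hu
    · exact Finset.some_mem_insertNone.2 hv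
    · exact Finset.some_mem_insertNone.2 hk
    · exact Finset.some_mem_insertNone.2 hl
    · exact Finset.mem_insertNone.2 (by simp)
  -- lifted distinctness
  have hxu' : (some x : Option V) ≠ some u := fun h => hxu (Option.some_injective _ h)
  have hxv' : (some x : Option V) ≠ some v := fun h => hxv (Option.some_injective _ h)
  have hxk' : (some x : Option V) ≠ some k := fun h => hxk (Option.some_injective _ h)
  have hxl' : (some x : Option V) ≠ some l := fun h => hxl (Option.some_injective _ h)
  have huv' : (some u : Option V) ≠ some v := fun h => huv (Option.some_injective _ h)
  have huk' : (some u : Option V) ≠ some k := fun h => huk (Option.some_injective _ h)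
  have hul' : (some u : Option V) ≠ some l := fun h => hul (Option.some_injective _ h)
  have hvk' : (some v : Option V) ≠ some k := fun h => hvk (Option.some_injective _ h)
  have hvl' : (some v : Option V) ≠ some l := fun h => hvl (Option.some_injective _ h)
  have hkl' : (some k : Option V) ≠ some l := fun h => hkl (Option.some_injective _ h)
  -- Step A: κ₃ in terms of the three pair sums
  set Ec : ℝ := thetaCorr G Λ θ' ({u} ∆ {v}) with hEc
  set E'c : ℝ := thetaCorr G Λ θ' ({k} ∆ {l}) with hE'c
  have hEc0 : 0 ≤ Ec := thetaCorr_nonneg hθ' (hsub2 hu hv)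
  have hE'c0 : 0 ≤ E'c := thetaCorr_nonneg hθ' (hsub2 hk hl)
  have hA : thetaK3 G Λ θ' (spinAt x) (spinProduct ({u} ∆ {v})) (spinProduct ({k} ∆ {l})) =
      ((currentPairSum G Λ θ' YA ∅ (fun m => ind (¬Conn[m, some x, none]))).toReal -
        E'c * (currentPairSum G Λ θ' YE ∅ (fun m => ind (¬Conn[m, some x, none]))).toReal -
        Ec * (currentPairSum G Λ θ' YE' ∅ (fun m => ind (¬Conn[m, some x, none]))).toReal) / Z ^ 2 := by
    rw [thetaK3_spin_prod_prod_eq, thetaCorr_symmDiff_sub_mul_eq hθ' hx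
        (symmDiff_le_sup.trans (sup_le (hsub2 hu hv) (hsub2 hk hl)) : (({u} ∆ {v}) ∆ ({k} ∆ {l}) : Finset V) ⊆ Λ),
      thetaCorr_symmDiff_sub_mul_eq hθ' hx (hsub2 hu hv), thetaCorr_symmDiff_sub_mul_eq hθ' hx (hsub2 hk hl),
      starSet_five_eq hxu hxv hxk hxl huv huk hul hvk hvl hkl, starSet_three_eq hxu hxv huv, starSet_three_eq hxk hxl hkl,
      ← hZ, ← hEc, ← hE'c]
    ring
  -- Step B: expansions
  have hexpA := toReal_currentPairSum_notConn_single_eq_sum' (G := G) (Λ := Λ) hθ' x YA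
  have hexpE := toReal_currentPairSum_notConn_single_eq_sum' (G := G) (Λ := Λ) hθ' x YE
  have hexpE' := toReal_currentPairSum_notConn_single_eq_sum' (G := G) (Λ := Λ) hθ' x YE'
  -- Step C: the per-`S` inequality
  have hper : ∀ S ∈ P', Q YA S - E'c * Q YE S - Ec * Q YE' S ≤
      ((M l * G0 v k + M k * G0 v l) * q u S + (M l * G0 u k + M k * G0 u l) * q v S +
        (M v * G0 l u + M u * G0 l v) * q k S + (M v * G0 k u + M u * G0 k v) * q l S) +
      (M l * ρ u v k S + M k * ρ u v l S + M v * ρ l u k S + M u * ρ l v k S) := by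
    intro S hS
    obtain ⟨hSΛ, hnS⟩ := mem_filter.1 hS
    have hSΛ' : S ⊆ Λg := mem_powerset.1 hSΛ
    -- the right-hand side is nonnegative
    have hcu : 0 ≤ M l * G0 v k + M k * G0 v l := add_nonneg (mul_nonneg (hM0 l hl) (hG00 v k hv hk)) (mul_nonneg (hM0 k hk) (hG00 v l hv hl))
    have hcv : 0 ≤ M l * G0 u k + M k * G0 u l := add_nonneg (mul_nonneg (hM0 l hl) (hG00 u k hu hk)) (mul_nonneg (hM0 k hk) (hG00 u l hu hl))
    have hck : 0 ≤ M v * G0 l u + M u * G0 l v := add_nonneg (mul_nonneg (hM0 v hv) (hG00 l u hl hu)) (mul_nonneg (hM0 u hu) (hG00 l v hl hv))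
    have hcl : 0 ≤ M v * G0 k u + M u * G0 k v := add_nonneg (mul_nonneg (hM0 v hv) (hG00 k u hk hu)) (mul_nonneg (hM0 u hu) (hG00 k v hk hv))
    have hRHS : 0 ≤ ((M l * G0 v k + M k * G0 v l) * q u S + (M l * G0 u k + M k * G0 u l) * q v S +
        (M v * G0 l u + M u * G0 l v) * q k S + (M v * G0 k u + M u * G0 k v) * q l S) +
        (M l * ρ u v k S + M k * ρ u v l S + M v * ρ l u k S + M u * ρ l v k S) := by
      refine add_nonneg (add_nonneg (add_nonneg (add_nonneg ?_ ?_) ?_) ?_) (add_nonneg (add_nonneg (add_nonneg ?_ ?_) ?_) ?_)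
      · exact mul_nonneg hcu (hq0 u S)
      · exact mul_nonneg hcv (hq0 v S)
      · exact mul_nonneg hck (hq0 k S)
      · exact mul_nonneg hcl (hq0 l S)
      · exact mul_nonneg (hM0 l hl) (hρ0 _ _ _ _)
      · exact mul_nonneg (hM0 k hk) (hρ0 _ _ _ _)
      · exact mul_nonneg (hM0 v hv) (hρ0 _ _ _ _)
      · exact mul_nonneg (hM0 u hu) (hρ0 _ _ _ _)
    -- the negative terms can always be dropped
    have hdropE : Q YA S - E'c * Q YE S - Ec * Q YE' S ≤ Q YA S - E'c * Q YE S := by nlinarith [hQ0 YE' S]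
    have hdropE' : Q YA S - E'c * Q YE S - Ec * Q YE' S ≤ Q YA S - Ec * Q YE' S := by nlinarith [hQ0 YE S]
    have hdropAll : Q YA S - E'c * Q YE S - Ec * Q YE' S ≤ Q YA S := by nlinarith [hQ0 YE S, hQ0 YE' S]
    by_cases hxS : (some x : Option V) ∈ S
    · -- impossible value of `𝒮_x`
      have h0 : ∀ Y, Q Y S = 0 := fun Y => by
        simp only [hQ]
        rw [show (fun m => ind (𝒮[m, some x] = S)) = (fun m : Eg → ℕ => ind (𝒮[m, some x] = S) * 1) from
          funext fun _ => (mul_one _).symm, currentPairSum_clusterCompl_eq_zero_of_mem θ' hxS]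
        simp
      rw [h0, h0, h0]; simpa using hRHS
    have hxS' : (some x : Option V) ∈ Λg \ S := mem_sdiff.2 ⟨Finset.some_mem_insertNone.2 hx, hxS⟩
    -- the restricted system and its Griffiths bounds
    set θS := cplOff θ' (Eg \ edgesIn Gg S) with hθSdef
    have hθS : ∀ e, 0 ≤ θS e := cplOff_nonneg hθ' _
    have hθSle : ∀ e, θS e ≤ θ' e := cplOff_le hθ' _
    have hzle : ∀ e, zeroField θS e ≤ zeroField θ e := by
      intro e; unfold zeroField
      split_ifs
      · exact le_rfl
      · exact (hθSle e).trans (hle e)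
    have hMS : ∀ {d : V}, d ∈ Λ → thetaCorr G Λ θS {d} ≤ M d := fun {d} hd =>
      (thetaCorr_cplOff_le hθ' _ (singleton_subset_iff.2 hd)).trans (thetaCorr_mono hθ' hle (singleton_subset_iff.2 hd))
    have hTS : ∀ {b c : V}, b ∈ Λ → c ∈ Λ →
        thetaCorr G Λ θS ({b} ∆ {c}) - thetaCorr G Λ θS {b} * thetaCorr G Λ θS {c} ≤ G0 b c := fun {b c} hb hc =>
      thetaCorr_pair_sub_mul_le_of_zeroField_le hθS hzle hb hc
    have hMS0 : ∀ {d : V}, d ∈ Λ → 0 ≤ thetaCorr G Λ θS {d} := fun {d} hd => thetaCorr_nonneg hθS (singleton_subset_iff.2 hd)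
    -- the truncated three-point function of the restricted system is bounded by `c_·`
    have h3 : ∀ {z a b : V}, z ∈ Λ → a ∈ Λ → b ∈ Λ → z ≠ a → z ≠ b → a ≠ b →
        thetaCorr G Λ θS ({z} ∆ ({a} ∆ {b})) - thetaCorr G Λ θ' ({a} ∆ {b}) * thetaCorr G Λ θS {z} ≤
          M b * G0 z a + M a * G0 z b := by
      intro z a b hz ha hb hza hzb hab
      have hpair : thetaCorr G Λ θS ({a} ∆ {b}) ≤ thetaCorr G Λ θ' ({a} ∆ {b}) := thetaCorr_cplOff_le hθ' _ (hsub2 ha hb)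
      have hstep : thetaCorr G Λ θS ({z} ∆ ({a} ∆ {b})) - thetaCorr G Λ θ' ({a} ∆ {b}) * thetaCorr G Λ θS {z} ≤
          thetaCorr G Λ θS ({z} ∆ ({a} ∆ {b})) - thetaCorr G Λ θS {z} * thetaCorr G Λ θS ({a} ∆ {b}) := by
        nlinarith [hMS0 hz]
      refine hstep.trans ((thetaTrunc_three_le hθS hz ha hb hza hzb hab).trans ?_)
      have h1 := hTS hz ha
      have h2 := hTS hz hb
      have hm1 := hMS hb
      have hm2 := hMS ha
      have hT1 : 0 ≤ thetaCorr G Λ θS ({z} ∆ {a}) - thetaCorr G Λ θS {z} * thetaCorr G Λ θS {a} :=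
        sub_nonneg.2 (thetaCorr_mul_le_symmDiff hθS (singleton_subset_iff.2 hz) (singleton_subset_iff.2 ha))
      have hT2 : 0 ≤ thetaCorr G Λ θS ({z} ∆ {b}) - thetaCorr G Λ θS {z} * thetaCorr G Λ θS {b} :=
        sub_nonneg.2 (thetaCorr_mul_le_symmDiff hθS (singleton_subset_iff.2 hz) (singleton_subset_iff.2 hb))
      calc thetaCorr G Λ θS {b} * (thetaCorr G Λ θS ({z} ∆ {a}) - thetaCorr G Λ θS {z} * thetaCorr G Λ θS {a}) +
            thetaCorr G Λ θS {a} * (thetaCorr G Λ θS ({z} ∆ {b}) - thetaCorr G Λ θS {z} * thetaCorr G Λ θS {b})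
          ≤ M b * (thetaCorr G Λ θS ({z} ∆ {a}) - thetaCorr G Λ θS {z} * thetaCorr G Λ θS {a}) +
            M a * (thetaCorr G Λ θS ({z} ∆ {b}) - thetaCorr G Λ θS {z} * thetaCorr G Λ θS {b}) :=
            add_le_add (mul_le_mul_of_nonneg_right hm1 hT1) (mul_le_mul_of_nonneg_right hm2 hT2)
        _ ≤ M b * G0 z a + M a * G0 z b :=
            add_le_add (mul_le_mul_of_nonneg_left h1 (hM0 b hb)) (mul_le_mul_of_nonneg_left h2 (hM0 a ha))
    -- the factorisation of `Q` for a given inside/outside splitting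
    have hfac : ∀ {Y : Finset (Option V)} {B : Finset V} {Yout : Finset (Option V)}, B ⊆ Λ →
        Y.filter (· ∈ S) = starSet B → Y.filter (· ∉ S) = Yout →
        Q Y S = thetaCorr G Λ θS B * Q Yout S := by
      intro Y B Yout hB hin hout
      simp only [hQ]
      rw [toReal_currentPairSum_clusterCompl_single_eq hθ' hSΛ' hxS' hB hin, hout]
    -- the vanishing of `Q` for an odd number of outer sources
    have hvan : ∀ {Y : Finset (Option V)}, Y ⊆ Λg → Odd #(Y.filter (· ∉ S)) → Q Y S = 0 := by
      intro Y hY hodd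
      simp only [hQ]
      rw [show (fun m => ind (𝒮[m, some x] = S)) = (fun m : Eg → ℕ => ind (𝒮[m, some x] = S) * 1) from
        funext fun _ => (mul_one _).symm, currentPairSum_clusterCompl_eq_zero_of_odd θ' hY hodd]
      simp
    -- the triple classes: `Q YA = ⟨σ_d⟩_S ρ`
    have hρeq : ∀ {a b c d : V}, a ∈ Λ → b ∈ Λ → c ∈ Λ → d ∈ Λ →
        (some x : Option V) ≠ some a → (some x : Option V) ≠ some b → (some x : Option V) ≠ some c →
        (some a : Option V) ≠ some b → (some a : Option V) ≠ some c → (some b : Option V) ≠ some c →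
        (some a : Option V) ∉ S → (some b : Option V) ∉ S → (some c : Option V) ∉ S →
        YA.filter (· ∈ S) = starSet {d} → YA.filter (· ∉ S) = {some x, some a, some b, some c} →
        Q YA S ≤ M d * ρ a b c S := by
      intro a b c d ha hb hc hd hxa hxb hxc hab hac hbc haS hbS hcS hin hout
      rw [hfac (singleton_subset_iff.2 hd) hin hout]
      have hQρ : Q {some x, some a, some b, some c} S = ρ a b c S := by
        simp only [hQ, hρ]
        rw [← pair_symmDiff_pair_eq_four hxa hxb hxc hab hac hbc]
        refine congrArg ENNReal.toReal (currentPairSum_congr (G := G) (Λ := Λ) fun n₁ n₂ _ _ => ?_)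
        by_cases hSm : 𝒮[n₁ + n₂, some x] = S
        · rw [ind_of_true hSm, ind_of_true (cconn_of_clusterCompl_eq_of_not_mem hSm ha haS),
            ind_of_true (cconn_of_clusterCompl_eq_of_not_mem hSm hb hbS),
            ind_of_true (cconn_of_clusterCompl_eq_of_not_mem hSm hc hcS)]
          simp
        · rw [ind_of_false hSm, zero_mul]
      rw [hQρ]
      exact mul_le_mul_of_nonneg_right (hMS hd) (hρ0 _ _ _ _)
    -- case analysis on the membership pattern of `u, v, k, l`
    by_cases huS : (some u : Option V) ∈ S <;> by_cases hvS : (some v : Option V) ∈ S <;>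
      by_cases hkS : (some k : Option V) ∈ S <;> by_cases hlS : (some l : Option V) ∈ S
    · -- (in,in,in,in)
      have hQ0' : Q YA S = 0 := hvan hYAΛ (by
        have h : YA.filter (· ∉ S) = ({some x} : Finset (Option V)) := by
          simp [hYA, Finset.filter_insert, Finset.filter_singleton, hxS, huS, hvS, hkS, hlS, hnS]
        rw [h, card_singleton]; exact odd_one)
      linarith [hdropAll]
    · -- (in,in,in,out)
      have hin : YA.filter (· ∈ S) = starSet ({u} ∆ ({v} ∆ {k})) := by
        rw [starSet_three_eq huv huk hvk]; simp [hYA, Finset.filter_insert, Finset.filter_singleton, hxS, huS, hvS, hkS, hlS, hnS]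
      have hout : YA.filter (· ∉ S) = {some x} ∆ {some l} := by
        rw [Current.symmDiff_singleton_eq_pair hxl']; simp [hYA, Finset.filter_insert, Finset.filter_singleton, hxS, huS, hvS, hkS, hlS, hnS]
      have hinE' : YE'.filter (· ∈ S) = starSet {k} := by
        rw [starSet_singleton, Current.symmDiff_singleton_eq_pair (Option.some_ne_none k)]; simp [hYE', Finset.filter_insert, Finset.filter_singleton, hxS, hkS, hlS, hnS]
      have houtE' : YE'.filter (· ∉ S) = {some x} ∆ {some l} := by
        rw [Current.symmDiff_singleton_eq_pair hxl']; simp [hYE', Finset.filter_insert, Finset.filter_singleton, hxS, hkS, hlS, hnS]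
      have hQA := hfac (symmDiff_le_sup.trans (sup_le (singleton_subset_iff.2 hu) (hsub2 hv hk)) :
        ({u} ∆ ({v} ∆ {k}) : Finset V) ⊆ Λ) hin hout
      have hQE' := hfac (singleton_subset_iff.2 hk) hinE' houtE'
      refine hdropE'.trans ?_
      rw [hQA, hQE']
      have hset : ({u} ∆ ({v} ∆ {k}) : Finset V) = {k} ∆ ({u} ∆ {v}) := by
        rw [symmDiff_comm ({v} : Finset V) {k}]; exact symmDiff_left_comm _ _ _
      rw [hset]
      have hb := h3 hk hu hv (Ne.symm huk) (Ne.symm hvk) huv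
      have hfin : (thetaCorr G Λ θS ({k} ∆ ({u} ∆ {v})) - Ec * thetaCorr G Λ θS {k}) * q l S ≤
          (M v * G0 k u + M u * G0 k v) * q l S := mul_le_mul_of_nonneg_right hb (hq0 l S)
      nlinarith [hfin, hRHS, mul_nonneg hcu (hq0 u S), mul_nonneg hcv (hq0 v S), mul_nonneg hck (hq0 k S), mul_nonneg hcl (hq0 l S),
        mul_nonneg (hM0 l hl) (hρ0 u v k S), mul_nonneg (hM0 k hk) (hρ0 u v l S), mul_nonneg (hM0 v hv) (hρ0 l u k S), mul_nonneg (hM0 u hu) (hρ0 l v k S)]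
    · -- (in,in,out,in)
      have hin : YA.filter (· ∈ S) = starSet ({u} ∆ ({v} ∆ {l})) := by
        rw [starSet_three_eq huv hul hvl]; simp [hYA, Finset.filter_insert, Finset.filter_singleton, hxS, huS, hvS, hkS, hlS, hnS]
      have hout : YA.filter (· ∉ S) = {some x} ∆ {some k} := by
        rw [Current.symmDiff_singleton_eq_pair hxk']; simp [hYA, Finset.filter_insert, Finset.filter_singleton, hxS, huS, hvS, hkS, hlS, hnS]
      have hinE' : YE'.filter (· ∈ S) = starSet {l} := by
        rw [starSet_singleton, Current.symmDiff_singleton_eq_pair (Option.some_ne_none l)]; simp [hYE', Finset.filter_insert, Finset.filter_singleton, hxS, hkS, hlS, hnS]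
      have houtE' : YE'.filter (· ∉ S) = {some x} ∆ {some k} := by
        rw [Current.symmDiff_singleton_eq_pair hxk']; simp [hYE', Finset.filter_insert, Finset.filter_singleton, hxS, hkS, hlS, hnS]
      have hQA := hfac (symmDiff_le_sup.trans (sup_le (singleton_subset_iff.2 hu) (hsub2 hv hl)) :
        ({u} ∆ ({v} ∆ {l}) : Finset V) ⊆ Λ) hin hout
      have hQE' := hfac (singleton_subset_iff.2 hl) hinE' houtE'
      refine hdropE'.trans ?_
      rw [hQA, hQE']
      have hset : ({u} ∆ ({v} ∆ {l}) : Finset V) = {l} ∆ ({u} ∆ {v}) := by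
        rw [symmDiff_comm ({v} : Finset V) {l}]; exact symmDiff_left_comm _ _ _
      rw [hset]
      have hb := h3 hl hu hv (Ne.symm hul) (Ne.symm hvl) huv
      have hfin : (thetaCorr G Λ θS ({l} ∆ ({u} ∆ {v})) - Ec * thetaCorr G Λ θS {l}) * q k S ≤
          (M v * G0 l u + M u * G0 l v) * q k S := mul_le_mul_of_nonneg_right hb (hq0 k S)
      nlinarith [hfin, hRHS, mul_nonneg hcu (hq0 u S), mul_nonneg hcv (hq0 v S), mul_nonneg hck (hq0 k S), mul_nonneg hcl (hq0 l S),
        mul_nonneg (hM0 l hl) (hρ0 u v k S), mul_nonneg (hM0 k hk) (hρ0 u v l S), mul_nonneg (hM0 v hv) (hρ0 l u k S), mul_nonneg (hM0 u hu) (hρ0 l v k S)]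
    · -- (in,in,out,out)
      have hQ0' : Q YA S = 0 := hvan hYAΛ (by
        have h : YA.filter (· ∉ S) = ({some x, some k, some l} : Finset (Option V)) := by
          simp [hYA, Finset.filter_insert, Finset.filter_singleton, hxS, huS, hvS, hkS, hlS, hnS]
        rw [h, card_insert_of_notMem (by simp [hxk', hxl']), card_pair hkl']; exact ⟨1, by norm_num⟩)
      linarith [hdropAll]
    · -- (in,out,in,in)
      have hin : YA.filter (· ∈ S) = starSet ({u} ∆ ({k} ∆ {l})) := by
        rw [starSet_three_eq huk hul hkl]; simp [hYA, Finset.filter_insert, Finset.filter_singleton, hxS, huS, hvS, hkS, hlS, hnS]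
      have hout : YA.filter (· ∉ S) = {some x} ∆ {some v} := by
        rw [Current.symmDiff_singleton_eq_pair hxv']; simp [hYA, Finset.filter_insert, Finset.filter_singleton, hxS, huS, hvS, hkS, hlS, hnS]
      have hinE : YE.filter (· ∈ S) = starSet {u} := by
        rw [starSet_singleton, Current.symmDiff_singleton_eq_pair (Option.some_ne_none u)]; simp [hYE, Finset.filter_insert, Finset.filter_singleton, hxS, huS, hvS, hnS]
      have houtE : YE.filter (· ∉ S) = {some x} ∆ {some v} := by
        rw [Current.symmDiff_singleton_eq_pair hxv']; simp [hYE, Finset.filter_insert, Finset.filter_singleton, hxS, huS, hvS, hnS]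
      have hQA := hfac (symmDiff_le_sup.trans (sup_le (singleton_subset_iff.2 hu) (hsub2 hk hl)) :
        ({u} ∆ ({k} ∆ {l}) : Finset V) ⊆ Λ) hin hout
      have hQE := hfac (singleton_subset_iff.2 hu) hinE houtE
      refine hdropE.trans ?_
      rw [hQA, hQE]
      have hb := h3 hu hk hl huk hul hkl
      have hfin : (thetaCorr G Λ θS ({u} ∆ ({k} ∆ {l})) - E'c * thetaCorr G Λ θS {u}) * q v S ≤
          (M l * G0 u k + M k * G0 u l) * q v S := mul_le_mul_of_nonneg_right hb (hq0 v S)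
      nlinarith [hfin, hRHS, mul_nonneg hcu (hq0 u S), mul_nonneg hcv (hq0 v S), mul_nonneg hck (hq0 k S), mul_nonneg hcl (hq0 l S),
        mul_nonneg (hM0 l hl) (hρ0 u v k S), mul_nonneg (hM0 k hk) (hρ0 u v l S), mul_nonneg (hM0 v hv) (hρ0 l u k S), mul_nonneg (hM0 u hu) (hρ0 l v k S)]
    · -- (in,out,in,out)
      have hQ0' : Q YA S = 0 := hvan hYAΛ (by
        have h : YA.filter (· ∉ S) = ({some x, some v, some l} : Finset (Option V)) := by
          simp [hYA, Finset.filter_insert, Finset.filter_singleton, hxS, huS, hvS, hkS, hlS, hnS]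
        rw [h, card_insert_of_notMem (by simp [hxv', hxl']), card_pair hvl']; exact ⟨1, by norm_num⟩)
      linarith [hdropAll]
    · -- (in,out,out,in)
      have hQ0' : Q YA S = 0 := hvan hYAΛ (by
        have h : YA.filter (· ∉ S) = ({some x, some v, some k} : Finset (Option V)) := by
          simp [hYA, Finset.filter_insert, Finset.filter_singleton, hxS, huS, hvS, hkS, hlS, hnS]
        rw [h, card_insert_of_notMem (by simp [hxv', hxk']), card_pair hvk']; exact ⟨1, by norm_num⟩)
      linarith [hdropAll]
    · -- (in,out,out,out)
      have hin : YA.filter (· ∈ S) = starSet {u} := by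
        rw [starSet_singleton, Current.symmDiff_singleton_eq_pair (Option.some_ne_none u)]; simp [hYA, Finset.filter_insert, Finset.filter_singleton, hxS, huS, hvS, hkS, hlS, hnS]
      have hout0 : YA.filter (· ∉ S) = ({some x, some v, some k, some l} : Finset (Option V)) := by
        simp [hYA, Finset.filter_insert, Finset.filter_singleton, hxS, huS, hvS, hkS, hlS, hnS]
      have hout : YA.filter (· ∉ S) = ({some x, some l, some v, some k} : Finset (Option V)) :=
        hout0.trans (by ext w; simp only [mem_insert, mem_singleton]; tauto)
      have hfin := hρeq hl hv hk hu hxl' hxv' hxk' (Ne.symm hvl') (Ne.symm hkl') hvk' hlS hvS hkS hin hout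
      nlinarith [hdropAll, hfin, hRHS, mul_nonneg hcu (hq0 u S), mul_nonneg hcv (hq0 v S), mul_nonneg hck (hq0 k S), mul_nonneg hcl (hq0 l S),
        mul_nonneg (hM0 l hl) (hρ0 u v k S), mul_nonneg (hM0 k hk) (hρ0 u v l S), mul_nonneg (hM0 v hv) (hρ0 l u k S), mul_nonneg (hM0 u hu) (hρ0 l v k S)]
    · -- (out,in,in,in)
      have hin : YA.filter (· ∈ S) = starSet ({v} ∆ ({k} ∆ {l})) := by
        rw [starSet_three_eq hvk hvl hkl]; simp [hYA, Finset.filter_insert, Finset.filter_singleton, hxS, huS, hvS, hkS, hlS, hnS]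
      have hout : YA.filter (· ∉ S) = {some x} ∆ {some u} := by
        rw [Current.symmDiff_singleton_eq_pair hxu']; simp [hYA, Finset.filter_insert, Finset.filter_singleton, hxS, huS, hvS, hkS, hlS, hnS]
      have hinE : YE.filter (· ∈ S) = starSet {v} := by
        rw [starSet_singleton, Current.symmDiff_singleton_eq_pair (Option.some_ne_none v)]; simp [hYE, Finset.filter_insert, Finset.filter_singleton, hxS, huS, hvS, hnS]
      have houtE : YE.filter (· ∉ S) = {some x} ∆ {some u} := by
        rw [Current.symmDiff_singleton_eq_pair hxu']; simp [hYE, Finset.filter_insert, Finset.filter_singleton, hxS, huS, hvS, hnS]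
      have hQA := hfac (symmDiff_le_sup.trans (sup_le (singleton_subset_iff.2 hv) (hsub2 hk hl)) :
        ({v} ∆ ({k} ∆ {l}) : Finset V) ⊆ Λ) hin hout
      have hQE := hfac (singleton_subset_iff.2 hv) hinE houtE
      refine hdropE.trans ?_
      rw [hQA, hQE]
      have hb := h3 hv hk hl hvk hvl hkl
      have hfin : (thetaCorr G Λ θS ({v} ∆ ({k} ∆ {l})) - E'c * thetaCorr G Λ θS {v}) * q u S ≤
          (M l * G0 v k + M k * G0 v l) * q u S := mul_le_mul_of_nonneg_right hb (hq0 u S)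
      nlinarith [hfin, hRHS, mul_nonneg hcu (hq0 u S), mul_nonneg hcv (hq0 v S), mul_nonneg hck (hq0 k S), mul_nonneg hcl (hq0 l S),
        mul_nonneg (hM0 l hl) (hρ0 u v k S), mul_nonneg (hM0 k hk) (hρ0 u v l S), mul_nonneg (hM0 v hv) (hρ0 l u k S), mul_nonneg (hM0 u hu) (hρ0 l v k S)]
    · -- (out,in,in,out)
      have hQ0' : Q YA S = 0 := hvan hYAΛ (by
        have h : YA.filter (· ∉ S) = ({some x, some u, some l} : Finset (Option V)) := by
          simp [hYA, Finset.filter_insert, Finset.filter_singleton, hxS, huS, hvS, hkS, hlS, hnS]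
        rw [h, card_insert_of_notMem (by simp [hxu', hxl']), card_pair hul']; exact ⟨1, by norm_num⟩)
      linarith [hdropAll]
    · -- (out,in,out,in)
      have hQ0' : Q YA S = 0 := hvan hYAΛ (by
        have h : YA.filter (· ∉ S) = ({some x, some u, some k} : Finset (Option V)) := by
          simp [hYA, Finset.filter_insert, Finset.filter_singleton, hxS, huS, hvS, hkS, hlS, hnS]
        rw [h, card_insert_of_notMem (by simp [hxu', hxk']), card_pair huk']; exact ⟨1, by norm_num⟩)
      linarith [hdropAll]
    · -- (out,in,out,out)
      have hin : YA.filter (· ∈ S) = starSet {v} := by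
        rw [starSet_singleton, Current.symmDiff_singleton_eq_pair (Option.some_ne_none v)]; simp [hYA, Finset.filter_insert, Finset.filter_singleton, hxS, huS, hvS, hkS, hlS, hnS]
      have hout0 : YA.filter (· ∉ S) = ({some x, some u, some k, some l} : Finset (Option V)) := by
        simp [hYA, Finset.filter_insert, Finset.filter_singleton, hxS, huS, hvS, hkS, hlS, hnS]
      have hout : YA.filter (· ∉ S) = ({some x, some l, some u, some k} : Finset (Option V)) :=
        hout0.trans (by ext w; simp only [mem_insert, mem_singleton]; tauto)
      have hfin := hρeq hl hu hk hv hxl' hxu' hxk' (Ne.symm hul') (Ne.symm hkl') huk' hlS huS hkS hin hout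
      nlinarith [hdropAll, hfin, hRHS, mul_nonneg hcu (hq0 u S), mul_nonneg hcv (hq0 v S), mul_nonneg hck (hq0 k S), mul_nonneg hcl (hq0 l S),
        mul_nonneg (hM0 l hl) (hρ0 u v k S), mul_nonneg (hM0 k hk) (hρ0 u v l S), mul_nonneg (hM0 v hv) (hρ0 l u k S), mul_nonneg (hM0 u hu) (hρ0 l v k S)]
    · -- (out,out,in,in)
      have hQ0' : Q YA S = 0 := hvan hYAΛ (by
        have h : YA.filter (· ∉ S) = ({some x, some u, some v} : Finset (Option V)) := by
          simp [hYA, Finset.filter_insert, Finset.filter_singleton, hxS, huS, hvS, hkS, hlS, hnS]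
        rw [h, card_insert_of_notMem (by simp [hxu', hxv']), card_pair huv']; exact ⟨1, by norm_num⟩)
      linarith [hdropAll]
    · -- (out,out,in,out)
      have hin : YA.filter (· ∈ S) = starSet {k} := by
        rw [starSet_singleton, Current.symmDiff_singleton_eq_pair (Option.some_ne_none k)]; simp [hYA, Finset.filter_insert, Finset.filter_singleton, hxS, huS, hvS, hkS, hlS, hnS]
      have hout : YA.filter (· ∉ S) = ({some x, some u, some v, some l} : Finset (Option V)) := by
        simp [hYA, Finset.filter_insert, Finset.filter_singleton, hxS, huS, hvS, hkS, hlS, hnS]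
      have hfin := hρeq hu hv hl hk hxu' hxv' hxl' huv' hul' hvl' huS hvS hlS hin hout
      nlinarith [hdropAll, hfin, hRHS, mul_nonneg hcu (hq0 u S), mul_nonneg hcv (hq0 v S), mul_nonneg hck (hq0 k S), mul_nonneg hcl (hq0 l S),
        mul_nonneg (hM0 l hl) (hρ0 u v k S), mul_nonneg (hM0 k hk) (hρ0 u v l S), mul_nonneg (hM0 v hv) (hρ0 l u k S), mul_nonneg (hM0 u hu) (hρ0 l v k S)]
    · -- (out,out,out,in)
      have hin : YA.filter (· ∈ S) = starSet {l} := by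
        rw [starSet_singleton, Current.symmDiff_singleton_eq_pair (Option.some_ne_none l)]; simp [hYA, Finset.filter_insert, Finset.filter_singleton, hxS, huS, hvS, hkS, hlS, hnS]
      have hout : YA.filter (· ∉ S) = ({some x, some u, some v, some k} : Finset (Option V)) := by
        simp [hYA, Finset.filter_insert, Finset.filter_singleton, hxS, huS, hvS, hkS, hlS, hnS]
      have hfin := hρeq hu hv hk hl hxu' hxv' hxk' huv' huk' hvk' huS hvS hkS hin hout
      nlinarith [hdropAll, hfin, hRHS, mul_nonneg hcu (hq0 u S), mul_nonneg hcv (hq0 v S), mul_nonneg hck (hq0 k S), mul_nonneg hcl (hq0 l S),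
        mul_nonneg (hM0 l hl) (hρ0 u v k S), mul_nonneg (hM0 k hk) (hρ0 u v l S), mul_nonneg (hM0 v hv) (hρ0 l u k S), mul_nonneg (hM0 u hu) (hρ0 l v k S)]
    · -- (out,out,out,out)
      have hQ0' : Q YA S = 0 := hvan hYAΛ (by
        have h : YA.filter (· ∉ S) = ({some x, some u, some v, some k, some l} : Finset (Option V)) := by
          simp [hYA, Finset.filter_insert, Finset.filter_singleton, hxS, huS, hvS, hkS, hlS, hnS]
        rw [h, card_insert_of_notMem (by simp [hxu', hxv', hxk', hxl']), card_insert_of_notMem (by simp [huv', huk', hul']),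
            card_insert_of_notMem (by simp [hvk', hvl']), card_pair hkl']; exact ⟨2, by norm_num⟩)
      linarith [hdropAll]
  -- Step D: sum over `S` and identify the sums
  have hsumq : ∀ {a : V}, a ∈ Λ → ∑ S ∈ P', q a S = Z ^ 2 * Tt a := by
    intro a ha
    have h1 := thetaCorr_symmDiff_sub_mul_eq (G := G) (Λ := Λ) hθ' hx (singleton_subset_iff.2 ha : ({a} : Finset V) ⊆ Λ)
    rw [starSet_pair, ← hZ, toReal_currentPairSum_notConn_single_eq_sum' hθ'] at h1
    have : Tt a = (∑ S ∈ P', q a S) / Z ^ 2 := h1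
    rw [this, mul_div_cancel₀ _ hZ2.ne']
  have hsumρ : ∀ {a b c : V}, a ∈ Λ → b ∈ Λ → c ∈ Λ → ∑ S ∈ P', ρ a b c S ≤ G0 b c * (Z ^ 2 * Tt a) := by
    intro a b c ha hb hc
    have hI : ∀ m : Eg → ℕ, ind (Conn[m, some x, some a]) * ind (Conn[m, some x, some b]) * ind (Conn[m, some x, some c]) ≤ 1 :=
      fun m => le_trans (mul_le_mul' (mul_le_mul' (ind_le_one _) (ind_le_one _)) (ind_le_one _)) (by simp)
    have h1 := toReal_currentPairSum_notConn_single_eq_sum (G := G) (Λ := Λ) hθ' x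
      (({some x} ∆ {some a}) ∆ ({some b} ∆ {some c})) hI
    simp only [hρ]
    rw [← h1]
    refine (currentPairSum_four_conn_le hθ' hx ha hb hc).trans ?_
    rw [← hsumq ha]
    simp only [hq, hQ]
    rw [← toReal_currentPairSum_notConn_single_eq_sum' hθ']
    refine mul_le_mul_of_nonneg_right ?_ ENNReal.toReal_nonneg
    have hz : ∀ e, zeroField θ' e ≤ zeroField θ e := by
      intro e; unfold zeroField; split_ifs
      · exact le_rfl
      · exact hle e
    exact thetaCorr_mono (zeroField_nonneg hθ') hz (hsub2 hb hc)
  have hsum := sum_le_sum hper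
  rw [sum_sub_distrib, sum_sub_distrib, ← mul_sum, ← mul_sum] at hsum
  simp only [sum_add_distrib, ← mul_sum] at hsum
  rw [hsumq hu, hsumq hv, hsumq hk, hsumq hl] at hsum
  have hρ1 := hsumρ hu hv hk
  have hρ2 := hsumρ hu hv hl
  have hρ3 := hsumρ hl hu hk
  have hρ4 := hsumρ hl hv hk
  -- the left-hand side of `hsum` is `Z² κ₃`
  have hLHS : thetaK3 G Λ θ' (spinAt x) (spinProduct ({u} ∆ {v})) (spinProduct ({k} ∆ {l})) =
      (∑ S ∈ P', Q YA S - E'c * ∑ S ∈ P', Q YE S - Ec * ∑ S ∈ P', Q YE' S) / Z ^ 2 := by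
    rw [hA, hexpA, hexpE, hexpE']
  rw [hLHS, div_le_iff₀ hZ2]
  have hcu : 0 ≤ M l * G0 v k + M k * G0 v l := add_nonneg (mul_nonneg (hM0 l hl) (hG00 v k hv hk)) (mul_nonneg (hM0 k hk) (hG00 v l hv hl))
  have hTt0 : ∀ {a : V}, a ∈ Λ → 0 ≤ Tt a := fun {a} ha =>
    sub_nonneg.2 (thetaCorr_mul_le_symmDiff hθ' (singleton_subset_iff.2 hx) (singleton_subset_iff.2 ha))
  nlinarith [hsum, mul_le_mul_of_nonneg_left hρ1 (hM0 l hl), mul_le_mul_of_nonneg_left hρ2 (hM0 k hk),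
    mul_le_mul_of_nonneg_left hρ3 (hM0 v hv), mul_le_mul_of_nonneg_left hρ4 (hM0 u hu),
    hG0symm u k, hG0symm l u, hG0symm l v, hG0symm k u, hG0symm k v]

/-! ### Summing over `x`: Proposition 5.2 in the form used in (5.50)–(5.51) -/

/-- `κ₃(F; P; Q) = κ₃(F; Q; P)`. [folklore] -/
theorem thetaK3_comm (θ : Sym2 (Option V) → ℝ) (F P Q : SpinConfig V → ℝ) :
    thetaK3 G Λ θ F P Q = thetaK3 G Λ θ F Q P := by
  unfold thetaK3
  have e1 : (fun σ => F σ * P σ * Q σ) = fun σ => F σ * Q σ * P σ := funext fun σ => by ring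
  have e2 : (fun σ => P σ * Q σ) = fun σ => Q σ * P σ := funext fun σ => by ring
  rw [e1, e2]; ring

/-- The bond spin as a spin product. [folklore] -/
theorem spinAt_mul_spinAt_eq_spinProduct (u v : V) :
    (fun σ : SpinConfig V => spinAt u σ * spinAt v σ) = spinProduct ({u} ∆ {v}) := by
  funext σ
  rw [← spinProduct_singleton u, ← spinProduct_singleton v, spinProduct_mul_spinProduct]

/-- **The weak GHS bound on the summed truncated pair function of a diluted system**: for
`0 ≤ θ' ≤ θ` with uniform field `θ'_{z,g} = s > 0` and `⟨σ_a⟩_θ ≤ M̄`,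
`∑_{x ∈ Λ} ⟨σ_x;σ_a⟩_{θ'} ≤ M̄/s`. [cite: AizenmanFernandezJSP1986, §5.2, proof of Thm. 5.7, the bound on ⟨σ_y;σ_u⟩ in (5.51), p. 440] -/
theorem sum_thetaTrunc_le_div {θ θ' : Sym2 (Option V) → ℝ} (hθ' : ∀ e, 0 ≤ θ' e) (hle : ∀ e, θ' e ≤ θ e)
    {s : ℝ} (hs : 0 < s) (hfield : ∀ z ∈ Λ, θ' (ghostEdge z) = s) {Mb : ℝ} (hMb : ∀ a ∈ Λ, thetaCorr G Λ θ {a} ≤ Mb)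
    {a : V} (ha : a ∈ Λ) :
    ∑ x ∈ Λ, (thetaCorr G Λ θ' ({x} ∆ {a}) - thetaCorr G Λ θ' {x} * thetaCorr G Λ θ' {a}) ≤ Mb / s := by
  have h := thetaCorr_sum_field_trunc_le (G := G) (Λ := Λ) hθ' ha
  rw [sum_congr rfl fun z hz => by rw [hfield z hz], ← mul_sum] at h
  have hMa : thetaCorr G Λ θ' {a} ≤ Mb := (thetaCorr_mono hθ' hle (singleton_subset_iff.2 ha)).trans (hMb a ha)
  rw [le_div_iff₀ hs]
  calc (∑ x ∈ Λ, (thetaCorr G Λ θ' ({x} ∆ {a}) - thetaCorr G Λ θ' {x} * thetaCorr G Λ θ' {a})) * s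
      = s * ∑ z ∈ Λ, (thetaCorr G Λ θ' ({a} ∆ {z}) - thetaCorr G Λ θ' {a} * thetaCorr G Λ θ' {z}) := by
        rw [mul_comm]
        exact congrArg (s * ·) (sum_congr rfl fun z _ => by rw [symmDiff_comm, mul_comm])
    _ ≤ Mb := h.trans hMa

/-- **Adjacent bonds**: for `0 ≤ θ' ≤ θ` with uniform field `s > 0`, `⟨σ⟩_θ ≤ M̄`, and distinct
`w, a, b ∈ Λ`, `∑_x κ₃^{θ'}(σ_x; σ_wσ_a; σ_wσ_b) ≤ 2M̄·(M̄/s) + 2M̄`. [cite: AizenmanFernandezJSP1986, §5.1, Prop. 5.2 (coincident pairs) and §5.2, (5.50)–(5.51), pp. 426, 440] -/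
theorem sum_thetaK3_adjacent_le {θ θ' : Sym2 (Option V) → ℝ} (hθ' : ∀ e, 0 ≤ θ' e) (hle : ∀ e, θ' e ≤ θ e)
    {s : ℝ} (hs : 0 < s) (hfield : ∀ z ∈ Λ, θ' (ghostEdge z) = s) {Mb : ℝ} (hMb : ∀ a ∈ Λ, thetaCorr G Λ θ {a} ≤ Mb)
    {w a b : V} (hw : w ∈ Λ) (ha : a ∈ Λ) (hb : b ∈ Λ) (hwa : w ≠ a) (hwb : w ≠ b) (hab : a ≠ b) :
    ∑ x ∈ Λ, thetaK3 G Λ θ' (spinAt x) (spinProduct ({w} ∆ {a})) (spinProduct ({w} ∆ {b})) ≤ 2 * Mb * (Mb / s) + 2 * Mb := by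
  classical
  have hθ : ∀ e, 0 ≤ θ e := fun e => (hθ' e).trans (hle e)
  have hMb' : ∀ {d : V}, d ∈ Λ → thetaCorr G Λ θ' {d} ≤ Mb := fun {d} hd =>
    (thetaCorr_mono hθ' hle (singleton_subset_iff.2 hd)).trans (hMb d hd)
  have hM0' : ∀ {d : V}, d ∈ Λ → 0 ≤ thetaCorr G Λ θ' {d} := fun {d} hd => thetaCorr_nonneg hθ' (singleton_subset_iff.2 hd)
  have hMb0 : 0 ≤ Mb := (hM0' hw).trans (hMb' hw)
  set T : V → V → ℝ := fun x c => thetaCorr G Λ θ' ({x} ∆ {c}) - thetaCorr G Λ θ' {x} * thetaCorr G Λ θ' {c} with hT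
  have hT0 : ∀ x c, x ∈ Λ → c ∈ Λ → 0 ≤ T x c := fun x c hx hc =>
    sub_nonneg.2 (thetaCorr_mul_le_symmDiff hθ' (singleton_subset_iff.2 hx) (singleton_subset_iff.2 hc))
  have hsub2 : ∀ {p q : V}, p ∈ Λ → q ∈ Λ → ({p} ∆ {q} : Finset V) ⊆ Λ := fun hp hq =>
    symmDiff_le_sup.trans (sup_le (singleton_subset_iff.2 hp) (singleton_subset_iff.2 hq))
  -- pointwise bound
  have hpt : ∀ x ∈ Λ, thetaK3 G Λ θ' (spinAt x) (spinProduct ({w} ∆ {a})) (spinProduct ({w} ∆ {b})) ≤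
      Mb * (T x a + T x b) + ((if x = a then Mb else 0) + (if x = b then Mb else 0)) := by
    intro x hx
    have h1 := thetaK3_le_trunc (G := G) (Λ := Λ) hθ' hx (hsub2 hw ha) (hsub2 hw hb)
    have hEE : (({w} ∆ {a}) ∆ ({w} ∆ {b}) : Finset V) = {a} ∆ {b} := by
      ext t; simp only [mem_symmDiff, mem_singleton]; tauto
    rw [hEE] at h1
    refine h1.trans ?_
    have hrest0 : 0 ≤ Mb * (T x a + T x b) := mul_nonneg hMb0 (add_nonneg (hT0 x a hx ha) (hT0 x b hx hb))
    by_cases hxa : x = a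
    · subst hxa
      rw [if_pos rfl]
      have e : ({x} ∆ ({x} ∆ {b}) : Finset V) = {b} := symmDiff_symmDiff_cancel_left _ _
      rw [e]
      have hxb0 : 0 ≤ thetaCorr G Λ θ' ({x} ∆ {b}) := thetaCorr_nonneg hθ' (hsub2 hx hb)
      have : thetaCorr G Λ θ' {b} - thetaCorr G Λ θ' {x} * thetaCorr G Λ θ' ({x} ∆ {b}) ≤ Mb := by
        nlinarith [hMb' hb, hM0' hx]
      have hif : 0 ≤ (if x = b then Mb else 0) := by split_ifs <;> linarith
      linarith
    by_cases hxb : x = b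
    · subst hxb
      rw [if_neg hxa, if_pos rfl]
      have e : ({x} ∆ ({a} ∆ {x}) : Finset V) = {a} := by
        rw [symmDiff_comm ({a} : Finset V) {x}]; exact symmDiff_symmDiff_cancel_left _ _
      rw [e]
      have hax0 : 0 ≤ thetaCorr G Λ θ' ({a} ∆ {x}) := thetaCorr_nonneg hθ' (hsub2 ha hx)
      have : thetaCorr G Λ θ' {a} - thetaCorr G Λ θ' {x} * thetaCorr G Λ θ' ({a} ∆ {x}) ≤ Mb := by
        nlinarith [hMb' ha, hM0' hx]
      linarith
    rw [if_neg hxa, if_neg hxb, add_zero, add_zero]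
    refine (thetaTrunc_three_le hθ' hx ha hb hxa hxb hab).trans ?_
    calc thetaCorr G Λ θ' {b} * T x a + thetaCorr G Λ θ' {a} * T x b ≤ Mb * T x a + Mb * T x b :=
          add_le_add (mul_le_mul_of_nonneg_right (hMb' hb) (hT0 x a hx ha)) (mul_le_mul_of_nonneg_right (hMb' ha) (hT0 x b hx hb))
      _ = Mb * (T x a + T x b) := by ring
  refine (sum_le_sum hpt).trans ?_
  rw [sum_add_distrib, sum_add_distrib, ← mul_sum, sum_add_distrib, sum_ite_eq' Λ a, sum_ite_eq' Λ b, if_pos ha, if_pos hb]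
  have hsa := sum_thetaTrunc_le_div hθ' hle hs hfield hMb ha
  have hsb := sum_thetaTrunc_le_div hθ' hle hs hfield hMb hb
  nlinarith [mul_le_mul_of_nonneg_left (add_le_add hsa hsb) hMb0]

set_option maxHeartbeats 1600000 in
/-- **Aizenman–Fernández's Proposition 5.2, summed over `x`, for a diluted system** (the form
entering (5.50)–(5.51)): for couplings `0 ≤ θ' ≤ θ` with the same uniform field
`θ'_{z,g} = s > 0` (`z ∈ Λ`), `⟨σ_a⟩_θ ≤ M̄` (`a ∈ Λ`), and two distinct lattice bonds
`{u,v} ≠ {k,l}` inside `Λ`,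
`∑_{x ∈ Λ} κ₃^{θ'}(σ_x; σ_uσ_v; σ_kσ_l) ≤ 12 · M̄ (M̄/s + 1) · ∑_{b ∈ {u,v}} ∑_{c ∈ {k,l}} ⟨σ_bσ_c⟩_{θ,h=0}`
(the twelve terms of (5.4) with `∑_x ⟨σ_x;σ_a⟩_{θ'} ≤ M̄/s` (weak GHS) and the other factors
bounded in the full system (Griffiths II); coincident `x` and adjacent bonds are absorbed in
the `+1`, using `⟨σ_wσ_w⟩ = 1`). [cite: AizenmanFernandezJSP1986, §5.1, Prop. 5.2, eq. (5.4), p. 425, and §5.2, eqs. (5.50)–(5.51), pp. 440–441] -/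
theorem sum_thetaK3_le {θ θ' : Sym2 (Option V) → ℝ} (hθ' : ∀ e, 0 ≤ θ' e) (hle : ∀ e, θ' e ≤ θ e)
    {s : ℝ} (hs : 0 < s) (hfield : ∀ z ∈ Λ, θ' (ghostEdge z) = s) {Mb : ℝ} (hMb : ∀ a ∈ Λ, thetaCorr G Λ θ {a} ≤ Mb)
    {u v k l : V} (huv : s(u, v) ∈ edgesIn G Λ) (hkl : s(k, l) ∈ edgesIn G Λ) (hne : s(u, v) ≠ s(k, l)) :
    ∑ x ∈ Λ, thetaK3 G Λ θ' (spinAt x) (fun σ => spinAt u σ * spinAt v σ) (fun σ => spinAt k σ * spinAt l σ) ≤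
      12 * Mb * (Mb / s + 1) *
        (thetaCorr G Λ (zeroField θ) ({u} ∆ {k}) + thetaCorr G Λ (zeroField θ) ({u} ∆ {l}) +
          thetaCorr G Λ (zeroField θ) ({v} ∆ {k}) + thetaCorr G Λ (zeroField θ) ({v} ∆ {l})) := by
  classical
  have hθ : ∀ e, 0 ≤ θ e := fun e => (hθ' e).trans (hle e)
  obtain ⟨hadj1, hmem1⟩ := mem_edgesIn_iff.1 huv
  obtain ⟨hadj2, hmem2⟩ := mem_edgesIn_iff.1 hkl
  have huv' : u ≠ v := G.ne_of_adj ((SimpleGraph.mem_edgeSet G).1 hadj1)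
  have hkl' : k ≠ l := G.ne_of_adj ((SimpleGraph.mem_edgeSet G).1 hadj2)
  have hu : u ∈ Λ := hmem1 u (Sym2.mem_mk_left u v)
  have hv : v ∈ Λ := hmem1 v (Sym2.mem_mk_right u v)
  have hk : k ∈ Λ := hmem2 k (Sym2.mem_mk_left k l)
  have hl : l ∈ Λ := hmem2 l (Sym2.mem_mk_right k l)
  rw [spinAt_mul_spinAt_eq_spinProduct u v, spinAt_mul_spinAt_eq_spinProduct k l]
  -- the zero-field links
  set G0 : V → V → ℝ := fun b c => thetaCorr G Λ (zeroField θ) ({b} ∆ {c}) with hG0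
  have hsub2 : ∀ {p q : V}, p ∈ Λ → q ∈ Λ → ({p} ∆ {q} : Finset V) ⊆ Λ := fun hp hq =>
    symmDiff_le_sup.trans (sup_le (singleton_subset_iff.2 hp) (singleton_subset_iff.2 hq))
  have hG00 : ∀ {b c : V}, b ∈ Λ → c ∈ Λ → 0 ≤ G0 b c := fun hb hc => thetaCorr_nonneg (zeroField_nonneg hθ) (hsub2 hb hc)
  have hG0symm : ∀ b c, G0 b c = G0 c b := fun b c => by simp only [hG0, symmDiff_comm]
  have hG0self : ∀ b, G0 b b = 1 := fun b => by
    simp only [hG0]; rw [show ({b} ∆ {b} : Finset V) = ∅ from symmDiff_self _, thetaCorr_empty]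
  set S4 : ℝ := G0 u k + G0 u l + G0 v k + G0 v l with hS4
  have hS40 : 0 ≤ S4 := add_nonneg (add_nonneg (add_nonneg (hG00 hu hk) (hG00 hu hl)) (hG00 hv hk)) (hG00 hv hl)
  have hMb0 : 0 ≤ Mb := (thetaCorr_nonneg hθ (singleton_subset_iff.2 hu)).trans (hMb u hu)
  have hMs0 : 0 ≤ Mb / s := div_nonneg hMb0 hs.le
  -- adjacent bonds: the general bound absorbs `2M̄(M̄/s) + 2M̄` since `S4 ≥ 1`
  have hadj : ∀ {w a b : V}, w ∈ Λ → a ∈ Λ → b ∈ Λ → w ≠ a → w ≠ b → a ≠ b → 1 ≤ S4 →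
      ∑ x ∈ Λ, thetaK3 G Λ θ' (spinAt x) (spinProduct ({w} ∆ {a})) (spinProduct ({w} ∆ {b})) ≤
        12 * Mb * (Mb / s + 1) * S4 := by
    intro w a b hw ha hb hwa hwb hab h1
    refine (sum_thetaK3_adjacent_le hθ' hle hs hfield hMb hw ha hb hwa hwb hab).trans ?_
    nlinarith [mul_nonneg hMb0 hMs0, mul_le_mul_of_nonneg_left h1 (mul_nonneg hMb0 (add_nonneg hMs0 zero_le_one))]
  by_cases huk : u = k
  · subst huk
    have hvl : v ≠ l := fun h => hne (by rw [h])
    exact hadj hu hv hl huv' hkl' hvl (by rw [hS4, hG0self]; linarith [hG00 hu hl, hG00 hv hu, hG00 hv hl])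
  by_cases hul : u = l
  · subst hul
    have hvk : v ≠ k := fun h => hne (by rw [h, Sym2.eq_swap])
    rw [symmDiff_comm ({k} : Finset V) {u}]
    exact hadj hu hv hk huv' (Ne.symm hkl') hvk (by rw [hS4, hG0self]; linarith [hG00 hu hk, hG00 hv hk, hG00 hv hu])
  by_cases hvk : v = k
  · subst hvk
    rw [symmDiff_comm ({u} : Finset V) {v}]
    exact hadj hv hu hl (Ne.symm huv') hkl' hul (by rw [hS4, hG0self]; linarith [hG00 hu hv, hG00 hu hl, hG00 hv hl])
  by_cases hvl : v = l
  · subst hvl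
    rw [symmDiff_comm ({u} : Finset V) {v}, symmDiff_comm ({k} : Finset V) {v}]
    exact hadj hv hu hk (Ne.symm huv') (Ne.symm hkl') huk (by rw [hS4, hG0self]; linarith [hG00 hu hk, hG00 hu hv, hG00 hv hk])
  -- disjoint bonds
  set T : V → V → ℝ := fun x c => thetaCorr G Λ θ' ({x} ∆ {c}) - thetaCorr G Λ θ' {x} * thetaCorr G Λ θ' {c} with hT
  have hT0 : ∀ {x c : V}, x ∈ Λ → c ∈ Λ → 0 ≤ T x c := fun hx hc =>
    sub_nonneg.2 (thetaCorr_mul_le_symmDiff hθ' (singleton_subset_iff.2 hx) (singleton_subset_iff.2 hc))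
  have hz : ∀ e, zeroField θ' e ≤ zeroField θ e := by
    intro e; unfold zeroField; split_ifs
    · exact le_rfl
    · exact hle e
  have hTG : ∀ {b c : V}, b ∈ Λ → c ∈ Λ → T b c ≤ G0 b c := fun hb hc => thetaCorr_pair_sub_mul_le_of_zeroField_le hθ' hz hb hc
  have hMb' : ∀ {d : V}, d ∈ Λ → thetaCorr G Λ θ' {d} ≤ Mb := fun {d} hd =>
    (thetaCorr_mono hθ' hle (singleton_subset_iff.2 hd)).trans (hMb d hd)
  have hM' : ∀ {d : V}, d ∈ Λ → thetaCorr G Λ θ {d} ≤ Mb := fun {d} hd => hMb d hd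
  have hM0 : ∀ {d : V}, d ∈ Λ → 0 ≤ thetaCorr G Λ θ {d} := fun {d} hd => thetaCorr_nonneg hθ (singleton_subset_iff.2 hd)
  have hM0' : ∀ {d : V}, d ∈ Λ → 0 ≤ thetaCorr G Λ θ' {d} := fun {d} hd => thetaCorr_nonneg hθ' (singleton_subset_iff.2 hd)
  -- the coincident bound: `⟨σ_z; σ_aσ_b⟩' ≤ M̄ (G0 z a + G0 z b)`
  have hco : ∀ {z a b : V}, z ∈ Λ → a ∈ Λ → b ∈ Λ → z ≠ a → z ≠ b → a ≠ b →
      thetaCorr G Λ θ' ({z} ∆ ({a} ∆ {b})) - thetaCorr G Λ θ' {z} * thetaCorr G Λ θ' ({a} ∆ {b}) ≤ Mb * (G0 z a + G0 z b) := by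
    intro z a b hz' ha hb hza hzb hab
    refine (thetaTrunc_three_le hθ' hz' ha hb hza hzb hab).trans ?_
    calc thetaCorr G Λ θ' {b} * T z a + thetaCorr G Λ θ' {a} * T z b ≤ Mb * G0 z a + Mb * G0 z b :=
          add_le_add ((mul_le_mul_of_nonneg_right (hMb' hb) (hT0 hz' ha)).trans (mul_le_mul_of_nonneg_left (hTG hz' ha) hMb0))
            ((mul_le_mul_of_nonneg_right (hMb' ha) (hT0 hz' hb)).trans (mul_le_mul_of_nonneg_left (hTG hz' hb) hMb0))
      _ = Mb * (G0 z a + G0 z b) := by ring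
  have hMS4 : 0 ≤ Mb * S4 := mul_nonneg hMb0 hS40
  -- pointwise bound
  have hpt : ∀ x ∈ Λ, thetaK3 G Λ θ' (spinAt x) (spinProduct ({u} ∆ {v})) (spinProduct ({k} ∆ {l})) ≤
      Mb * S4 * (2 * T x u + T x v + T x k + 2 * T x l) +
        ((if x = u then Mb * S4 else 0) + (if x = v then Mb * S4 else 0) + (if x = k then Mb * S4 else 0) +
          (if x = l then Mb * S4 else 0)) := by
    intro x hx
    have hTsum0 : ∀ {y : V}, y ∈ Λ → 0 ≤ Mb * S4 * (2 * T y u + T y v + T y k + 2 * T y l) := fun {y} hy => by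
      have := hT0 hy hu; have := hT0 hy hv; have := hT0 hy hk; have := hT0 hy hl
      exact mul_nonneg hMS4 (by linarith)
    by_cases hxu : x = u
    · have hxv : x ≠ v := fun h => huv' (hxu.symm.trans h)
      have hxk : x ≠ k := fun h => huk (hxu.symm.trans h)
      have hxl : x ≠ l := fun h => hul (hxu.symm.trans h)
      rw [if_pos hxu, if_neg hxv, if_neg hxk, if_neg hxl, hxu]
      have h := thetaK3_coincident_le (G := G) (Λ := Λ) hθ' hu hv (hsub2 hk hl)
      have h2 := hco hv hk hl hvk hvl hkl'
      have h3 : Mb * (G0 v k + G0 v l) ≤ Mb * S4 := mul_le_mul_of_nonneg_left (by linarith [hG00 hu hk, hG00 hu hl]) hMb0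
      linarith [hTsum0 hu]
    by_cases hxv : x = v
    · have hxk : x ≠ k := fun h => hvk (hxv.symm.trans h)
      have hxl : x ≠ l := fun h => hvl (hxv.symm.trans h)
      rw [if_neg hxu, if_pos hxv, if_neg hxk, if_neg hxl, hxv, symmDiff_comm ({u} : Finset V) {v}]
      have h := thetaK3_coincident_le (G := G) (Λ := Λ) hθ' hv hu (hsub2 hk hl)
      have h2 := hco hu hk hl huk hul hkl'
      have h3 : Mb * (G0 u k + G0 u l) ≤ Mb * S4 := mul_le_mul_of_nonneg_left (by linarith [hG00 hv hk, hG00 hv hl]) hMb0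
      linarith [hTsum0 hv]
    by_cases hxk : x = k
    · have hxl : x ≠ l := fun h => hkl' (hxk.symm.trans h)
      rw [if_neg hxu, if_neg hxv, if_pos hxk, if_neg hxl, hxk, thetaK3_comm]
      have h := thetaK3_coincident_le (G := G) (Λ := Λ) hθ' hk hl (hsub2 hu hv)
      have h2 := hco hl hu hv (Ne.symm hul) (Ne.symm hvl) huv'
      have h3 : Mb * (G0 l u + G0 l v) ≤ Mb * S4 :=
        mul_le_mul_of_nonneg_left (by linarith [hG00 hu hk, hG00 hv hk, hG0symm l u, hG0symm l v]) hMb0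
      linarith [hTsum0 hk]
    by_cases hxl : x = l
    · rw [if_neg hxu, if_neg hxv, if_neg hxk, if_pos hxl, hxl, thetaK3_comm, symmDiff_comm ({k} : Finset V) {l}]
      have h := thetaK3_coincident_le (G := G) (Λ := Λ) hθ' hl hk (hsub2 hu hv)
      have h2 := hco hk hu hv (Ne.symm huk) (Ne.symm hvk) huv'
      have h3 : Mb * (G0 k u + G0 k v) ≤ Mb * S4 :=
        mul_le_mul_of_nonneg_left (by linarith [hG00 hu hl, hG00 hv hl, hG0symm k u, hG0symm k v]) hMb0
      have h4 := hTsum0 hl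
      linarith
    rw [if_neg hxu, if_neg hxv, if_neg hxk, if_neg hxl, add_zero, add_zero, add_zero, add_zero]
    have h := thetaK3_disjoint_le (G := G) (Λ := Λ) hθ' hle hx hu hv hk hl hxu hxv hxk hxl huv' huk hul hvk hvl hkl'
    refine h.trans ?_
    -- bound the coefficients by `M̄ S4`
    have c1 : thetaCorr G Λ θ {l} * G0 v k + thetaCorr G Λ θ {k} * G0 v l ≤ Mb * S4 := by
      nlinarith [mul_le_mul_of_nonneg_right (hM' hl) (hG00 hv hk), mul_le_mul_of_nonneg_right (hM' hk) (hG00 hv hl),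
        hG00 hu hk, hG00 hu hl]
    have c2 : thetaCorr G Λ θ {l} * G0 u k + thetaCorr G Λ θ {k} * G0 u l ≤ Mb * S4 := by
      nlinarith [mul_le_mul_of_nonneg_right (hM' hl) (hG00 hu hk), mul_le_mul_of_nonneg_right (hM' hk) (hG00 hu hl),
        hG00 hv hk, hG00 hv hl]
    have c3 : thetaCorr G Λ θ {v} * G0 l u + thetaCorr G Λ θ {u} * G0 l v ≤ Mb * S4 := by
      nlinarith [mul_le_mul_of_nonneg_right (hM' hv) (hG00 hl hu), mul_le_mul_of_nonneg_right (hM' hu) (hG00 hl hv),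
        hG00 hu hk, hG00 hv hk, hG0symm l u, hG0symm l v]
    have c4 : thetaCorr G Λ θ {v} * G0 k u + thetaCorr G Λ θ {u} * G0 k v ≤ Mb * S4 := by
      nlinarith [mul_le_mul_of_nonneg_right (hM' hv) (hG00 hk hu), mul_le_mul_of_nonneg_right (hM' hu) (hG00 hk hv),
        hG00 hu hl, hG00 hv hl, hG0symm k u, hG0symm k v]
    have c5 : thetaCorr G Λ θ {v} * G0 u k + thetaCorr G Λ θ {u} * G0 v k ≤ Mb * S4 := by
      nlinarith [mul_le_mul_of_nonneg_right (hM' hv) (hG00 hu hk), mul_le_mul_of_nonneg_right (hM' hu) (hG00 hv hk),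
        hG00 hu hl, hG00 hv hl]
    have p1 := mul_le_mul_of_nonneg_right c1 (hT0 hx hu)
    have p2 := mul_le_mul_of_nonneg_right c2 (hT0 hx hv)
    have p3 := mul_le_mul_of_nonneg_right c3 (hT0 hx hk)
    have p4 := mul_le_mul_of_nonneg_right c4 (hT0 hx hl)
    have p5 := mul_le_mul_of_nonneg_right c5 (hT0 hx hl)
    linarith
  refine (sum_le_sum hpt).trans ?_
  rw [sum_add_distrib, ← mul_sum]
  simp only [sum_add_distrib, sum_ite_eq' Λ, if_pos hu, if_pos hv, if_pos hk, if_pos hl, ← mul_sum]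
  have hsu := sum_thetaTrunc_le_div hθ' hle hs hfield hMb hu
  have hsv := sum_thetaTrunc_le_div hθ' hle hs hfield hMb hv
  have hsk := sum_thetaTrunc_le_div hθ' hle hs hfield hMb hk
  have hsl := sum_thetaTrunc_le_div hθ' hle hs hfield hMb hl
  have q1 := mul_le_mul_of_nonneg_left hsu hMS4
  have q2 := mul_le_mul_of_nonneg_left hsv hMS4
  have q3 := mul_le_mul_of_nonneg_left hsk hMS4
  have q4 := mul_le_mul_of_nonneg_left hsl hMS4
  have q5 : 0 ≤ Mb * S4 * (Mb / s) := mul_nonneg hMS4 hMs0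
  have hexp : 12 * Mb * (Mb / s + 1) * S4 = 12 * (Mb * S4 * (Mb / s)) + 12 * (Mb * S4) := by ring
  rw [hexp]
  linarith

end Kappa3

end Literature.Probability.LatticeModels
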